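/-
Copyright (c) 2026 the pub-hodgecm-mathlib formalisation cell (harness21).  Prover seat hodgecm-mathlib-LH4-p03 (g4) on line LH3 (closer stub `stub_N9`, N9 «Transf» road),
organ (PARTNER) P3 «chart classes ∕ partner count» (LH3-plan (g2) ruling (3) 2026-09-02T06:28:37Z; LH3-p03 (g2) census P3 06:22:15Z); 2026-09-02.
-/
import Literature.NumberTheory.Rogawski1990.ArchTransfFamily                 -- ★ p849747 (LH7-p02 (g2)): `slotPerm`, `slotSign`, `partnerPerms`, `partnerWeight`, `IsIndefiniteAt`; brings ★ `gprimeTorus` ∕ `gprimeBlock` (atlas PART 2b)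
import Literature.NumberTheory.Automorphic.ArchStableClassRegularTorus        -- ★ (V8) F0P3a-p02: `isConj_circleDiagonal_iff_exists_perm` (place criterion), `im_embedding_diagonal_eq_zero`, `isConj_arch_iff_forall_place`
import HarnessLib

/-!
# (PARTNER) P3 — the `G′_∞`-CLASSES of the chart partners `gprimeTorus α S (slotPerm ρ c)`, `ρ ∈ partnerPerms S`: the slot-sign criterion, the fibre count
# `∏_{w ∉ S} (2 or 6) = partnerWeight⁻¹`, and the class sum as a partner sum (Rogawski 1990 §3.7–§3.8, §4.1 (4.1.1), §8.2 Prop. 8.2.1, §14.2; Shelstad 1979 Lemma 4.2)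

Topic `NumberTheory/Rogawski1990`; namespace `Literature.NumberTheory.Rogawski1990`.  THEOREMS ONLY (no `def`, no instance, no notation, no axiom, no named fact, no `sorry`);
kernel lane `--supports stmt-HodgeConjecture-24833`.  Cell `pub/hodgecm-mathlib` (D-0151), crux H413 = `stmt-HodgeConjecture-24833`; line LH3 (closer stub `stub_N9`, N9 «Transf»
DIRECT ROAD), organ (PARTNER) P3 of LH3-p03 (g2)'s census (P1 = ★ `ArchChartNormPairs`, P2 = (EXH-G′)); consumer: the READ-side chart sum `ArchTransferSideChartSum` («the
finsum over `ConjClasses G′_∞` of `Δ(γH, out c′)·Φ(c′)` at `γH = endoTorus S c` is `partnerWeight · Σ_{ρ ∈ partnerPerms S} …`») and organ O-L2 (`transfFamReg`'s normalisation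
★ `partnerWeight`).  HONEST LABEL: HC_CM is proved only modulo the 7 printed citations (2 remaining: hLiu418 = stmt-HodgeConjecture-24832, h413 = stmt-HodgeConjecture-24833)
until rung 0 closes; count-neutral kit (group theory ∕ combinatorics of the atlas), pays nothing by itself.

THE MATHEMATICS.  `G′_∞ = U(diag α)(L⁺ ⊗ ℝ) = ↥(arch L⁺ L c 3 (diagonal α))` (house frame: `α_i ≠ 0`, `c α_i = α_i`).  Conjugacy in `G′_∞` is PLACE-WISE (★ `isConj_arch_iff_forall_place`)
and the `w`-component of `gprimeTorus α S c` is `gprimeBlock α w S c` (★ `archPiEquivCM_gprimeTorus`).  For two PARTNERS `slotPerm ρ c`, `slotPerm ρ′ c` (`ρ, ρ′ ∈ partnerPerms S`,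
i.e. `ρ_w = ρ′_w = 1` on `S`): at a SPLIT place `w ∈ S` the two components are EQUAL (the chart only reads `c w`, and `slotPerm ρ c w = c w`), so the realised reflection
`x ↦ −x` (★ (NEGX-CONJ)) plays no role for the partner family; at a COMPACT place `w ∉ S` the component is the diagonal torus point `diag(ℓ ↦ e^{i c w (ρ_w (τ_w⁻¹ ℓ))})`,
`τ_w = lineOf (formSign L α w)`, and ★ `isConj_circleDiagonal_iff_exists_perm` (F0P3a-p02, (V8): `diag z ∼_{G_w} diag z′ ↔ ∃ π, z′ = z ∘ π ∧ π` preserves `sgn re σ_w α`) with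
`z` injective for `c ∈ RegG S` forces `π = τ_w ρ_w⁻¹ ρ′_w τ_w⁻¹`; the sign test on the lines `τ_w k` is `slotSign`-invariance on SLOTS.  Hence
**`⟦gprimeTorus α S (slotPerm ρ c)⟧ = ⟦gprimeTorus α S (slotPerm ρ′ c)⟧ ↔ ∀ w ∉ S, slotSign L α w ∘ (ρ_w⁻¹ ρ′_w) = slotSign L α w`** — the realised Weyl group of the compact
chart at `w` is the stabiliser of the slot colouring: all of `S₃` at a definite place (`U(3)`), `{1, (0 1)}` at an indefinite place (`U(2,1)`: slots `0, 1` carry the two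
even-sign lines) [Rogawski §3.7 p. 30: `Ω(T,G) = ℤ∕2` over `ℝ`; §8.2 Prop. 8.2.1: three classes].  COUNT: the fibre of `ρ ↦ ⟦gprimeTorus α S (slotPerm ρ c)⟧` through `ρ₀` is
`{ρ₀ · π | π_w = 1 (w ∈ S), π_w ∈ Stab(slotSign w) (w ∉ S)}`, of cardinality **`∏_{w ∉ S} (2 if w indefinite else 6) = (partnerWeight L α S)⁻¹`** (★ `partnerWeight` is
DEFINED as `∏_{w ∉ S} (2 or 6)⁻¹`), so for every class function `F`:
**`Σ_{ρ ∈ partnerPerms S} F ⟦gprimeTorus α S (slotPerm ρ c)⟧ = partnerWeight⁻¹ · Σ_{q ∈ classes} F q`**, i.e. `Σ_{classes} = partnerWeight · Σ_ρ` — the normalisation of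
★ `transfFamReg`.  (S = ∅ twins in `archDiagTorus` currency: ★ `mk_archDiagTorus_eq_mk_iff`, ★ `card_filter_mk_archDiagTorus_eq_prod_factorial`.)

* §1 combinatorics: `sign_eq_sign_iff_of_ne_zero`, `card_filter_perm_vec_three_stab`, **`card_filter_perm_slotStab`** (`= 2 ∕ 6`), `slotSign_ne_zero`;
* §2 chart bookkeeping: `gprimeBlock_congr_apply`, `gprimeBlock_of_not_mem_eq_circleDiagonal`, `injective_exp_slotPerm_comp`;
* §3 **`mk_gprimeTorus_slotPerm_eq_mk_iff`** (the criterion; no `splitChartPlaces` hypothesis needed);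
* §4 **`card_filter_partnerPerms_mk_gprimeTorus_slotPerm_eq`** (fibre `= ∏_{w ∉ S} (2 or 6)`), `natCast_prod_stabCard_mul_partnerWeight` (`N · partnerWeight = 1`);
* §5 **`sum_partnerPerms_eq_card_mul_sum_image`**, **`sum_image_eq_partnerWeight_mul_sum_partnerPerms`** (class sum = `partnerWeight ·` partner sum).

## References
* [Rogawski1990] J. D. Rogawski, *Automorphic Representations of Unitary Groups in Three Variables*, Ann. of Math. Stud. 123 (1990): §3.7 Prop. 3.7.1 pp. 29–30 (`Ω_F(T,G) = S₃`,
  `Ω(T,G) = ℤ∕2` over `ℝ`), §3.8 Prop. 3.8.1 p. 30, §4.1 (4.1.1) p. 39, §4.3 (4.3.1) p. 43, §8.2 Prop. 8.2.1 p. 118, §14.2 p. 232 (definite places: one class).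
* [Shelstad1979] D. Shelstad, *Characters and inner forms of a quasi-split group over ℝ*, Compositio Math. 39 (1979), §4 pp. 22–23, Lemma 4.2 p. 23 (the relabelled partners).
* [BrockerTomDieck1985] Th. Bröcker, T. tom Dieck, *Representations of Compact Lie Groups*, GTM 98 (1985), Ch. IV (3.1)–(3.2) (Weyl group of the diagonal torus).
-/

set_option autoImplicit false

noncomputable section

open NumberField NumberField.InfinitePlace Complex Equiv Finset
open scoped MatrixGroups ComplexConjugate Classical
open Literature.NumberTheory.Automorphic Literature.NumberTheory.Automorphic.UnitaryGroup Literature.NumberTheory.GaloisRepresentations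

namespace Literature.NumberTheory.Rogawski1990

/-! ## §1 Combinatorics of the slot colouring -/

/-- Two non-zero reals have the same sign iff they are positive together. [cite: BrockerTomDieck1985, Ch. IV (3.2)] -/
theorem sign_eq_sign_iff_of_ne_zero {x y : ℝ} (hx : x ≠ 0) (hy : y ≠ 0) : SignType.sign x = SignType.sign y ↔ (0 < x ↔ 0 < y) := by
  rcases lt_or_gt_of_ne hx with hxn | hxp <;> rcases lt_or_gt_of_ne hy with hyn | hyp
  · rw [sign_neg hxn, sign_neg hyn]
    exact ⟨fun _ => ⟨fun h => absurd h (lt_asymm hxn), fun h => absurd h (lt_asymm hyn)⟩, fun _ => rfl⟩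
  · rw [sign_neg hxn, sign_pos hyp]
    exact ⟨fun h => absurd h (by decide), fun h => absurd (h.2 hyp) (lt_asymm hxn)⟩
  · rw [sign_pos hxp, sign_neg hyn]
    exact ⟨fun h => absurd h (by decide), fun h => absurd (h.1 hxp) (lt_asymm hyn)⟩
  · rw [sign_pos hxp, sign_pos hyp]
    exact ⟨fun _ => ⟨fun _ => hyp, fun _ => hxp⟩, fun _ => rfl⟩

/-- **The stabiliser in `S₃` of a nowhere-zero colouring `(a, b, c)` of the three slots** has `2` elements if the colours are not all equal, `6` if they are (by `decide` on the
eight sign patterns). [cite: Rogawski1990, §3.7 Prop. 3.7.1 p. 30] [cite: BrockerTomDieck1985, Ch. IV (3.2)] -/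
theorem card_filter_perm_vec_three_stab (a b c : SignType) (ha : a ≠ 0) (hb : b ≠ 0) (hc : c ≠ 0) :
    (Finset.univ.filter fun π : Perm (Fin 3) => ∀ k : Fin 3, (![a, b, c] : Fin 3 → SignType) (π k) = (![a, b, c] : Fin 3 → SignType) k).card =
      if ¬ (a = b ∧ b = c) then 2 else 6 := by
  cases a <;> cases b <;> cases c <;> first | exact absurd rfl ha | exact absurd rfl hb | exact absurd rfl hc | decide

/-- **THE REALISED COMPACT WEYL GROUP, COUNTED**: for a nowhere-zero slot colouring `s : Fin 3 → SignType`, `#{π ∈ S₃ | s ∘ π = s} = 2` if `s` is indefinite (not constant),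
`6` if definite. [cite: Rogawski1990, §3.7 Prop. 3.7.1 p. 30; §14.2 p. 232] -/
theorem card_filter_perm_slotStab (s : Fin 3 → SignType) (hs : ∀ k, s k ≠ 0) :
    (Finset.univ.filter fun π : Perm (Fin 3) => ∀ k : Fin 3, s (π k) = s k).card = if ¬ (s 0 = s 1 ∧ s 1 = s 2) then 2 else 6 := by
  have hs' : s = ![s 0, s 1, s 2] := by funext k; fin_cases k <;> rfl
  have h := card_filter_perm_vec_three_stab (s 0) (s 1) (s 2) (hs 0) (hs 1) (hs 2)
  rw [← hs'] at h
  exact h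

section Frame

variable (L : Type) [Field L] (α : Fin 3 → L)

/-- In the house frame (`α_i ≠ 0`, `σ_w α_i` real) no slot sign vanishes: `slotSign L α w k ≠ 0`. [cite: Rogawski1990, §3.6 p. 31] -/
theorem slotSign_ne_zero {w : {w : InfinitePlace L // IsComplex w}} (hα : ∀ i, α i ≠ 0) (hreal : ∀ i, (w.1.embedding (α i)).im = 0) (k : Fin 3) :
    slotSign L α w k ≠ 0 := by
  rw [slotSign_apply]
  show SignType.sign (formRe L α w (lineOf (formSign L α w) k)) ≠ 0
  rw [Ne, sign_eq_zero_iff]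
  exact formRe_ne_zero hα hreal _

/-- `slotSign L α w j = slotSign L α w k` iff the two lines `τ_w j`, `τ_w k` have form entries of the same positivity (`τ_w = lineOf (formSign L α w)`).
[cite: Rogawski1990, §3.6 p. 31] -/
theorem slotSign_eq_slotSign_iff {w : {w : InfinitePlace L // IsComplex w}} (hα : ∀ i, α i ≠ 0) (hreal : ∀ i, (w.1.embedding (α i)).im = 0) (j k : Fin 3) :
    slotSign L α w j = slotSign L α w k ↔
      (0 < (w.1.embedding (α (lineOf (formSign L α w) j))).re ↔ 0 < (w.1.embedding (α (lineOf (formSign L α w) k))).re) := by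
  rw [slotSign_apply, slotSign_apply]
  show SignType.sign (formRe L α w (lineOf (formSign L α w) j)) = SignType.sign (formRe L α w (lineOf (formSign L α w) k)) ↔ _
  exact sign_eq_sign_iff_of_ne_zero (formRe_ne_zero hα hreal _) (formRe_ne_zero hα hreal _)

end Frame

/-! ## §2 Chart bookkeeping at one place -/

section Chart

variable (L : Type) [Field L] [NumberField L] [IsCMField L] (α : Fin 3 → L)

omit [NumberField L] [IsCMField L] in
/-- The `w`-component of the chart only reads `c w`. [cite: Rogawski1990, §3.6 p. 31] -/
theorem gprimeBlock_congr_apply {S : Finset {w : InfinitePlace L // IsComplex w}} {c c' : {w : InfinitePlace L // IsComplex w} → Fin 3 → ℝ}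
    {w : {w : InfinitePlace L // IsComplex w}} (h : c w = c' w) : gprimeBlock L α w S c = gprimeBlock L α w S c' := by
  unfold gprimeBlock
  simp only [h]

omit [NumberField L] [IsCMField L] in
/-- At a compact place `w ∉ S` the component is the diagonal torus point `diag(ℓ ↦ e^{i c w (τ_w⁻¹ ℓ)})` (★ `gprimeCptGL` unfolded). [cite: Rogawski1990, §3.6 p. 31; §4.9 p. 54] -/
theorem gprimeBlock_of_not_mem_eq_circleDiagonal {S : Finset {w : InfinitePlace L // IsComplex w}} {w : {w : InfinitePlace L // IsComplex w}} (hw : w ∉ S)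
    (c : {w : InfinitePlace L // IsComplex w} → Fin 3 → ℝ) :
    gprimeBlock L α w S c =
      ⟨circleDiagonal 3 (fun ℓ => Circle.exp (c w ((lineOf (formSign L α w)).symm ℓ))), circleDiagonal_mem_archLocal_diagonal L 3 α w _⟩ := by
  unfold gprimeBlock
  rw [dif_neg (fun h => hw h.1)]
  rfl

omit [NumberField L] [IsCMField L] in
/-- Regularity at a compact place survives the relabellings: `ℓ ↦ e^{i c w (ρ_w (τ_w⁻¹ ℓ))}` is injective when `k ↦ e^{i c w k}` is. [cite: Rogawski1990, §8.2 p. 118] -/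
theorem injective_exp_slotPerm_comp {c : {w : InfinitePlace L // IsComplex w} → Fin 3 → ℝ} {w : {w : InfinitePlace L // IsComplex w}}
    (hc : Function.Injective fun k : Fin 3 => Circle.exp (c w k)) (ρ : {w : InfinitePlace L // IsComplex w} → Perm (Fin 3)) :
    Function.Injective fun ℓ : Fin 3 => Circle.exp (slotPerm ρ c w ((lineOf (formSign L α w)).symm ℓ)) := by
  intro ℓ ℓ' h
  simp only [slotPerm_apply] at h
  have h1 := hc h
  simpa using h1

end Chart

/-! ## §3 The criterion: when two chart partners are conjugate in `G′_∞` -/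

section Classes

variable (L : Type) [Field L] [NumberField L] [IsCMField L] (α : Fin 3 → L)

/-- **CHART PARTNERS ARE `G′_∞`-CONJUGATE IFF THE RELATIVE RELABELLING PRESERVES THE SLOT SIGNS AT EVERY COMPACT PLACE.**  House frame (`α_i ≠ 0`, `c α_i = α_i`), `c` regular
at the compact places of `S` (`k ↦ e^{i c w k}` injective, `w ∉ S` — the compact clause of ★ `RegG S`), `ρ, ρ′ ∈ partnerPerms S`:
`⟦gprimeTorus α S (slotPerm ρ c)⟧ = ⟦gprimeTorus α S (slotPerm ρ′ c)⟧ ↔ ∀ w ∉ S, ∀ k, slotSign L α w ((ρ_w⁻¹ ρ′_w) k) = slotSign L α w k`.  Place-wise (★ `isConj_arch_iff_forall_place`):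
equal components on `S`; ★ `isConj_circleDiagonal_iff_exists_perm` at `w ∉ S` with the forced permutation `τ_w ρ_w⁻¹ ρ′_w τ_w⁻¹`.  No `splitChartPlaces` hypothesis is needed.
[cite: Rogawski1990, §3.7 Prop. 3.7.1 p. 30; §3.8 Prop. 3.8.1 p. 30; §8.2 Prop. 8.2.1 p. 118; §14.2 p. 232] [cite: Shelstad1979, Lemma 4.2 p. 23] -/
theorem mk_gprimeTorus_slotPerm_eq_mk_iff (hα : ∀ i, α i ≠ 0) (hherm : ∀ i, (IsCMField.complexConj L (α i) : L) = α i)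
    {S : Finset {w : InfinitePlace L // IsComplex w}} {c : {w : InfinitePlace L // IsComplex w} → Fin 3 → ℝ}
    (hc : ∀ w, w ∉ S → Function.Injective fun k : Fin 3 => Circle.exp (c w k))
    {ρ ρ' : {w : InfinitePlace L // IsComplex w} → Perm (Fin 3)} (hρ : ρ ∈ partnerPerms S) (hρ' : ρ' ∈ partnerPerms S) :
    ConjClasses.mk (gprimeTorus L α S (slotPerm ρ c)) = ConjClasses.mk (gprimeTorus L α S (slotPerm ρ' c)) ↔
      ∀ w, w ∉ S → ∀ k : Fin 3, slotSign L α w (((ρ w)⁻¹ * ρ' w) k) = slotSign L α w k := by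
  have hreal := im_embedding_diagonal_eq_zero L 3 α hherm
  rw [ConjClasses.mk_eq_mk_iff_isConj, isConj_arch_iff_forall_place]
  simp only [archPiEquivCM_gprimeTorus]
  constructor
  · intro h w hw k
    have hw' := h w
    rw [gprimeBlock_of_not_mem_eq_circleDiagonal L α hw, gprimeBlock_of_not_mem_eq_circleDiagonal L α hw,
      isConj_circleDiagonal_iff_exists_perm L 3 α w hα (hreal w) (injective_exp_slotPerm_comp L α (hc w hw) ρ)] at hw'
    obtain ⟨π, hπ, hsign⟩ := hw'
    -- the forced permutation: `π (τ k) = τ (ρ_w⁻¹ (ρ′_w k))`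
    have hπk : π (lineOf (formSign L α w) k) = lineOf (formSign L α w) (((ρ w)⁻¹ * ρ' w) k) := by
      have h1 := congrFun hπ (lineOf (formSign L α w) k)
      simp only [Function.comp_apply, slotPerm_apply, Equiv.symm_apply_apply] at h1
      -- `h1 : exp (c w (ρ′ k)) = exp (c w (ρ (τ⁻¹ (π (τ k)))))`
      have h2 : ρ' w k = ρ w ((lineOf (formSign L α w)).symm (π (lineOf (formSign L α w) k))) := hc w hw h1
      rw [Equiv.Perm.mul_apply, Equiv.Perm.inv_def, h2, Equiv.symm_apply_apply, Equiv.apply_symm_apply]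
    have hs := hsign (lineOf (formSign L α w) k)
    rw [hπk] at hs
    exact (slotSign_eq_slotSign_iff L α hα (hreal w) _ _).2 hs
  · intro h w
    by_cases hw : w ∈ S
    · rw [gprimeBlock_congr_apply L α (slotPerm_apply_of_mem hρ hw c), gprimeBlock_congr_apply L α (slotPerm_apply_of_mem hρ' hw c)]
    · rw [gprimeBlock_of_not_mem_eq_circleDiagonal L α hw, gprimeBlock_of_not_mem_eq_circleDiagonal L α hw,
        isConj_circleDiagonal_iff_exists_perm L 3 α w hα (hreal w) (injective_exp_slotPerm_comp L α (hc w hw) ρ)]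
      refine ⟨((lineOf (formSign L α w)).symm.trans ((ρ w)⁻¹ * ρ' w)).trans (lineOf (formSign L α w)), ?_, ?_⟩
      · funext ℓ
        simp only [Function.comp_apply, slotPerm_apply, Equiv.trans_apply, Equiv.symm_apply_apply, Equiv.Perm.mul_apply,
          Equiv.Perm.coe_inv, Equiv.apply_symm_apply]
      · intro i
        have hk := h w hw ((lineOf (formSign L α w)).symm i)
        rw [slotSign_eq_slotSign_iff L α hα (hreal w)] at hk
        simpa only [Equiv.trans_apply, Equiv.apply_symm_apply] using hk

/-! ## §4 The fibre count: `∏_{w ∉ S} (2 or 6)` partners per class -/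

/-- **EACH CLASS IS HIT `∏_{w ∉ S} (2 or 6)` TIMES BY `partnerPerms S`** (`2` at an indefinite compact place, `6` at a definite one, `1` at a split place): for `ρ₀ ∈ partnerPerms S`,
`#{ρ ∈ partnerPerms S | ⟦gprimeTorus α S (slotPerm ρ c)⟧ = ⟦gprimeTorus α S (slotPerm ρ₀ c)⟧} = ∏_{w ∉ S} (if IsIndefiniteAt (slotSign L α) w then 2 else 6)` — the fibre is
`ρ₀ · ∏_{w ∉ S} Stab(slotSign w)` (§3) and the stabilisers are counted in §1. [cite: Rogawski1990, §4.1 (4.1.1) p. 39; §8.2 Prop. 8.2.1 p. 118; §14.2 p. 232] [cite: Shelstad1979, Lemma 4.2 p. 23] -/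
theorem card_filter_partnerPerms_mk_gprimeTorus_slotPerm_eq (hα : ∀ i, α i ≠ 0) (hherm : ∀ i, (IsCMField.complexConj L (α i) : L) = α i)
    {S : Finset {w : InfinitePlace L // IsComplex w}} {c : {w : InfinitePlace L // IsComplex w} → Fin 3 → ℝ}
    (hc : ∀ w, w ∉ S → Function.Injective fun k : Fin 3 => Circle.exp (c w k))
    {ρ₀ : {w : InfinitePlace L // IsComplex w} → Perm (Fin 3)} (hρ₀ : ρ₀ ∈ partnerPerms S) :
    ((partnerPerms S).filter fun ρ => ConjClasses.mk (gprimeTorus L α S (slotPerm ρ c)) = ConjClasses.mk (gprimeTorus L α S (slotPerm ρ₀ c))).card =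
      ∏ w ∈ Finset.univ \ S, (if IsIndefiniteAt (slotSign L α) w then 2 else 6) := by
  have hreal := im_embedding_diagonal_eq_zero L 3 α hherm
  -- the stabiliser sets, place by place
  set T : {w : InfinitePlace L // IsComplex w} → Finset (Perm (Fin 3)) :=
    fun w => if w ∈ S then {1} else Finset.univ.filter fun π : Perm (Fin 3) => ∀ k : Fin 3, slotSign L α w (π k) = slotSign L α w k with hT
  have hTS : ∀ {w}, w ∈ S → T w = {1} := fun hw => by simp only [hT, if_pos hw]
  have hTc : ∀ {w}, w ∉ S → T w = Finset.univ.filter fun π : Perm (Fin 3) => ∀ k : Fin 3, slotSign L α w (π k) = slotSign L α w k :=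
    fun hw => by simp only [hT, if_neg hw]
  -- the fibre ≅ `Fintype.piFinset T` along `ρ ↦ ρ₀⁻¹ ρ`
  have hcard : ((partnerPerms S).filter fun ρ => ConjClasses.mk (gprimeTorus L α S (slotPerm ρ c)) = ConjClasses.mk (gprimeTorus L α S (slotPerm ρ₀ c))).card =
      (Fintype.piFinset T).card := by
    refine Finset.card_nbij' (fun ρ w => (ρ₀ w)⁻¹ * ρ w) (fun π w => ρ₀ w * π w) ?_ ?_ ?_ ?_
    · intro ρ hρ
      rw [Finset.mem_coe, Finset.mem_filter] at hρ
      obtain ⟨hρP, hρeq⟩ := hρ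
      rw [Finset.mem_coe, Fintype.mem_piFinset]
      intro w
      dsimp only
      by_cases hw : w ∈ S
      · rw [hTS hw, Finset.mem_singleton, eq_one_of_mem_partnerPerms hρ₀ hw, eq_one_of_mem_partnerPerms hρP hw, inv_one, one_mul]
      · rw [hTc hw, Finset.mem_filter]
        exact ⟨Finset.mem_univ _, ((mk_gprimeTorus_slotPerm_eq_mk_iff L α hα hherm hc hρ₀ hρP).1 hρeq.symm) w hw⟩
    · intro π hπ
      rw [Finset.mem_coe, Fintype.mem_piFinset] at hπ
      have hπS : ∀ w, w ∈ S → π w = 1 := fun w hw => by simpa [hTS hw] using hπ w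
      have hmem : (fun w => ρ₀ w * π w) ∈ partnerPerms S := by
        rw [mem_partnerPerms_iff]
        intro w hw
        rw [eq_one_of_mem_partnerPerms hρ₀ hw, hπS w hw, one_mul]
      rw [Finset.mem_coe, Finset.mem_filter]
      refine ⟨hmem, ((mk_gprimeTorus_slotPerm_eq_mk_iff L α hα hherm hc hρ₀ hmem).2 fun w hw k => ?_).symm⟩
      have hπw := hπ w
      rw [hTc hw, Finset.mem_filter] at hπw
      rw [inv_mul_cancel_left]
      exact hπw.2 k
    · intro ρ _
      funext w
      dsimp only
      rw [mul_inv_cancel_left]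
    · intro π _
      funext w
      dsimp only
      rw [inv_mul_cancel_left]
  rw [hcard, Fintype.card_piFinset]
  -- `∏_w #T w`: `1` on `S`, the stabiliser count off `S`
  rw [← Finset.prod_sdiff (Finset.subset_univ S)]
  have hS1 : ∏ w ∈ S, (T w).card = 1 := Finset.prod_eq_one fun w hw => by rw [hTS hw, Finset.card_singleton]
  rw [hS1, mul_one]
  refine Finset.prod_congr rfl fun w hw => ?_
  rw [Finset.mem_sdiff] at hw
  rw [hTc hw.2, card_filter_perm_slotStab (slotSign L α w) (slotSign_ne_zero L α hα (hreal w))]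
  unfold IsIndefiniteAt
  by_cases hind : ¬ (slotSign L α w 0 = slotSign L α w 1 ∧ slotSign L α w 1 = slotSign L α w 2)
  · rw [if_pos hind, if_pos hind]
  · rw [if_neg hind, if_neg hind]

omit [IsCMField L] in
/-- **`(#fibre) · partnerWeight = 1`**: ★ `partnerWeight L α S = ∏_{w ∉ S} (2 or 6)⁻¹` is by definition the inverse of the fibre count. [cite: Rogawski1990, §4.3 (4.3.1) p. 43; §14.2 p. 232] -/
theorem natCast_prod_stabCard_mul_partnerWeight (S : Finset {w : InfinitePlace L // IsComplex w}) :
    (((∏ w ∈ Finset.univ \ S, (if IsIndefiniteAt (slotSign L α) w then 2 else 6) : ℕ) : ℂ)) * partnerWeight L α S = 1 := by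
  unfold partnerWeight
  rw [Nat.cast_prod, ← Finset.prod_mul_distrib]
  refine Finset.prod_eq_one fun w _ => ?_
  split_ifs <;> norm_num

/-! ## §5 The class sum as a partner sum -/

/-- **`Σ_{ρ ∈ partnerPerms S} F ⟦gprimeTorus α S (slotPerm ρ c)⟧ = (∏_{w ∉ S} (2 or 6)) · Σ_{q ∈ classes} F q`** for every function `F` on the classes of `G′_∞` (the classes =
the image of `partnerPerms S`; Mathlib `Finset.sum_comp` with the constant fibre count of §4). [cite: Rogawski1990, §4.1 (4.1.1) p. 39; §4.3 (4.3.1) p. 43] -/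
theorem sum_partnerPerms_eq_card_mul_sum_image (hα : ∀ i, α i ≠ 0) (hherm : ∀ i, (IsCMField.complexConj L (α i) : L) = α i)
    {S : Finset {w : InfinitePlace L // IsComplex w}} {c : {w : InfinitePlace L // IsComplex w} → Fin 3 → ℝ}
    (hc : ∀ w, w ∉ S → Function.Injective fun k : Fin 3 => Circle.exp (c w k))
    (F : ConjClasses ↥(arch (↥(maximalRealSubfield L)) L (IsCMField.complexConj L) 3 (Matrix.diagonal α)) → ℂ) :
    ∑ ρ ∈ partnerPerms S, F (ConjClasses.mk (gprimeTorus L α S (slotPerm ρ c))) =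
      (((∏ w ∈ Finset.univ \ S, (if IsIndefiniteAt (slotSign L α) w then 2 else 6) : ℕ) : ℂ)) *
        ∑ q ∈ (partnerPerms S).image (fun ρ => ConjClasses.mk (gprimeTorus L α S (slotPerm ρ c))), F q := by
  rw [Finset.sum_comp F (fun ρ => ConjClasses.mk (gprimeTorus L α S (slotPerm ρ c))), Finset.mul_sum]
  refine Finset.sum_congr rfl fun q hq => ?_
  obtain ⟨ρ₀, hρ₀, rfl⟩ := Finset.mem_image.1 hq
  rw [card_filter_partnerPerms_mk_gprimeTorus_slotPerm_eq L α hα hherm hc hρ₀, nsmul_eq_mul]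

/-- **THE CLASS SUM IS `partnerWeight ·` THE PARTNER SUM**: `Σ_{q ∈ classes} F q = partnerWeight L α S · Σ_{ρ ∈ partnerPerms S} F ⟦gprimeTorus α S (slotPerm ρ c)⟧` — the normalisation
of ★ `transfFamReg` (print's `Σ_{[γ′]}` over the `G′_∞`-classes stably conjugate to `endoTorus S c`, once (EXH-G′) identifies them with the partner classes).
[cite: Rogawski1990, §4.1 (4.1.1) p. 39; §4.3 (4.3.1) p. 43; §14.2 p. 232] [cite: Shelstad1979, Lemma 4.2 p. 23] -/
theorem sum_image_eq_partnerWeight_mul_sum_partnerPerms (hα : ∀ i, α i ≠ 0) (hherm : ∀ i, (IsCMField.complexConj L (α i) : L) = α i)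
    {S : Finset {w : InfinitePlace L // IsComplex w}} {c : {w : InfinitePlace L // IsComplex w} → Fin 3 → ℝ}
    (hc : ∀ w, w ∉ S → Function.Injective fun k : Fin 3 => Circle.exp (c w k))
    (F : ConjClasses ↥(arch (↥(maximalRealSubfield L)) L (IsCMField.complexConj L) 3 (Matrix.diagonal α)) → ℂ) :
    ∑ q ∈ (partnerPerms S).image (fun ρ => ConjClasses.mk (gprimeTorus L α S (slotPerm ρ c))), F q =
      partnerWeight L α S * ∑ ρ ∈ partnerPerms S, F (ConjClasses.mk (gprimeTorus L α S (slotPerm ρ c))) := by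
  rw [sum_partnerPerms_eq_card_mul_sum_image L α hα hherm hc F, ← mul_assoc, mul_comm (partnerWeight L α S),
    natCast_prod_stabCard_mul_partnerWeight L α S, one_mul]

end Classes

end Literature.NumberTheory.Rogawski1990

end
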